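/-
Copyright (c) 2026 the pub-hodgecm-mathlib formalisation cell (harness21).  Prover seat hodgecm-mathlib-K2E1-p10 (g6), Track B ∕ K2-LIT, h413 =
`stmt-HodgeConjecture-24833`, route `HCCMUnconditional`; R90-TF S8 «ContSpec-n½», (M) road RES-INT (M-a) OF RECORD (census
`K2/K2E1-p10/g6/CENSUS-RES-INT-Ma.K2E1-p10-g6.md` e19e192b71e365b5 line 1; S8 dealer R90-CS-plan (g3) S8-R226 «line 1 `res_class_finset_sum` inside it or next»).
-/
import Summits.HodgeConjecture.HodgeConjecture.Theorems.R90S8ResGMidAtomTransOfFlatReexpansionU3   -- ★ p864527 (T_f) FILE B: `midPoleLetter_translate_eq_sum`, `rightRegular_apply_eq_sum_of_flatReexpansion`, `eisensteinSeriesU_finset_sum`, `coeFn_finset_sum_smul_ae`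
import Summits.HodgeConjecture.HodgeConjecture.Theorems.K2E1ChiIntertwinedCoeffKMaxCMThree         -- ★ `flatSectionU_finset_sum_smul` (flat sections are linear in `φ`)
import HarnessLib

/-!
# R90 · S8 «ContSpec-n½» — `R90S8ResidueClassLinearU3`: «LIN» — THE MIDDLE-POLE RESIDUE CLASS IS LINEAR IN THE SECTION: `Res (Σᵢ aᵢ ψᵢ) = Σᵢ aᵢ Res ψᵢ`
# (RES-INT (M-a) OF RECORD, line 1) [MoeglinWaldspurger1995 II.1.5, IV.1.11, V.3.13]

Cell `pub/hodgecm-mathlib`, crux H413 = `stmt-HodgeConjecture-24833` (lane `--kind proof --supports stmt-HodgeConjecture-24833 --as helper`), route of record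
`HCCMUnconditional`; programme R90-TF, section S8, the (M) socket road RES-INT (M-a).  THEOREMS ONLY: no `def`, no `instance`, no `notation`, no named-fact hypothesis, no
`sorry`, NO `Lines` import; default heartbeats.  CLOSES NO SOCKET.

THE MATHEMATICS.  D1's generator data `(φ, Ec, Sp, Fp, f)` (★ `resGMidAtomGen`) determine `Ec` (★ `eqOn_reSlit_of_eqOn_re_gt`), the residue function `Fp(·)(3∕2)` (★
`poleLetter_apply_eq_of_frequently_eq`) and the class `f` uniquely from `φ`; so «`Res φ := f`» is a MAP on sections carrying data, and it is LINEAR: if `φ = Σᵢ aᵢ ψᵢ` with data for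
`φ` and for each `ψᵢ`, then `Fp x (3∕2) = Σᵢ aᵢ Fpᵢ x (3∕2)` pointwise and `f = Σᵢ aᵢ • fᵢ` in `L²`.  DEVICE: this is ★ (T_f) FILE B (`midPoleLetter_translate_eq_sum`,
`rightRegular_apply_eq_sum_of_flatReexpansion`) at the TRIVIAL translate `g = 1` with weights `cᵢ = 1` and the SCALED pieces `aᵢ • ψᵢ` (data `aᵢ·Ecᵢ`, `aᵢ·Fpᵢ`, `aᵢ • fᵢ`: the
section space is a submodule, `E` and `flat` are linear — ★ `eisensteinSeriesU_smul`, ★ `flatSectionU_finset_sum_smul`); no new analysis.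

## CONTENTS (namespace `Summit.HodgeConjecture.HodgeConjecture.R90.S8`)
* §1 `midPoleLetter_apply_finset_sum` — the pointwise residue identity `Fp x (3∕2) = Σᵢ aᵢ · Fpᵢ x (3∕2)`.
* §2 **`res_class_finset_sum`** — `f = Σᵢ aᵢ • fᵢ` in `L²(G(F)∖G(𝔸))` (RES-INT line 1: `Res` is linear on every block of sections carrying T's data).
HONEST LABEL: HC_CM is proved only modulo the 7 printed citations (2 remaining named inputs: hLiu418 = `stmt-HodgeConjecture-24832`, h413 = `stmt-HodgeConjecture-24833`) until
rung 0 closes; REL ≠ ★ ≠ BUILT; bookkeeping over ★ (T_f) FILE B, conditional on the data clauses (T's exports) as binders; pays no socket; count-neutral.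

## References
* [MoeglinWaldspurger1995] C. Mœglin, J.-L. Waldspurger, *Spectral Decomposition and Eisenstein Series* (1995), II.1.5, IV.1.11, V.3.13.
* [Conway1978] J. B. Conway, *Functions of One Complex Variable*, 2nd ed., GTM 11 (1978), IV §3.
-/

set_option autoImplicit false
set_option linter.dupNamespace false  -- the mandated namespace `…HodgeConjecture.HodgeConjecture.R90.S8` repeats the summit's segment

noncomputable section

open MeasureTheory Measure Set Filter Topology NumberField ContRepresentation
open Literature.NumberTheory Literature.NumberTheory.Automorphic Literature.NumberTheory.Automorphic.UnitaryGroup Literature.NumberTheory.GaloisRepresentations AdelicGroupData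
open Literature.NumberTheory.Automorphic.Arthur2013.Leaves.TECR Literature.NumberTheory.Rogawski1990
open Summit.HodgeConjecture.HodgeConjecture.Cruxes.H413.K2E1BorelEisensteinU
open Summit.HodgeConjecture.HodgeConjecture.Cruxes.H413.K2E1CharacterEisensteinU3PairDefs
open Summit.HodgeConjecture.HodgeConjecture.Cruxes.H413.K2E1ChiSectionSpaceU3PairDefs
open Summit.HodgeConjecture.HodgeConjecture.Cruxes.H413.K2E1ChiIntertwinedCoeffKMaxCMThree (flatSectionU_finset_sum_smul)
open scoped ENNReal NNReal

namespace Summit.HodgeConjecture.HodgeConjecture.R90.S8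

variable (L : Type) [Field L] [NumberField L] [IsCMField L]
  (μ : Measure (quasiSplit (↥(maximalRealSubfield L)) L (IsCMField.complexConj L) 3).automorphicQuotient)
  [(quasiSplit (↥(maximalRealSubfield L)) L (IsCMField.complexConj L) 3).IsAutomorphicMeasure μ] (ξ : OneDimAutRepH L) (μω : HeckeCharacter L)

/-! ## §1 The pointwise residue identity for a finite combination of sections -/

omit [(quasiSplit (↥(maximalRealSubfield L)) L (IsCMField.complexConj L) 3).IsAutomorphicMeasure μ] in
/-- **`Fp x (3∕2) = Σᵢ aᵢ · Fpᵢ x (3∕2)`** for `φ = Σᵢ aᵢ • ψᵢ` (`ψᵢ` in the level-free pair-section space of the `φ_ξ`-block, continuous), given continuation data `(Ec, Sp, Fp)` for `φ`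
and `(Ecᵢ, Spᵢ, Fpᵢ)` for each `ψᵢ` (D1's clauses): ★ `midPoleLetter_translate_eq_sum` at `g = 1`, `cᵢ = 1`, pieces `aᵢ • ψᵢ` with data `(aᵢ·Ecᵢ, Spᵢ, aᵢ·Fpᵢ)`.
[cite: MoeglinWaldspurger1995, II.1.5, IV.1.11] [cite: Conway1978, IV §3] -/
theorem midPoleLetter_apply_finset_sum (hμu : μω.IsUnitary)
    {ι : Type*} (s : Finset ι) (a : ι → ℂ)
    (ψ : ι → (quasiSplit (↥(maximalRealSubfield L)) L (IsCMField.complexConj L) 3).Adelic → ℂ)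
    (hψ : ∀ i ∈ s, ψ i ∈ chiSectionSpacePair (ξ.bcη⁻¹ * ξ.bcψ⁻¹ * μω) ξ.ψ (⊥ : Subgroup (quasiSplit (↥(maximalRealSubfield L)) L (IsCMField.complexConj L) 3).Adelic)
      ((1 : ↥(⊥ : Subgroup (quasiSplit (↥(maximalRealSubfield L)) L (IsCMField.complexConj L) 3).Adelic) →* ℂ) :
        ↥(⊥ : Subgroup (quasiSplit (↥(maximalRealSubfield L)) L (IsCMField.complexConj L) 3).Adelic) → ℂ))
    (hψc : ∀ i ∈ s, Continuous (ψ i))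
    {φ : (quasiSplit (↥(maximalRealSubfield L)) L (IsCMField.complexConj L) 3).Adelic → ℂ} (hφ : φ = ∑ i ∈ s, a i • ψ i)
    (Ec : ℂ → (quasiSplit (↥(maximalRealSubfield L)) L (IsCMField.complexConj L) 3).Adelic → ℂ) (Sp : Finset ℂ) (hSp : ∀ t ∈ Sp, t.im = 0 ∧ 1 < t.re ∧ t.re ≤ 2)
    (hol : ∀ g, DifferentiableOn ℂ (fun z => Ec z g) ({z : ℂ | 1 < z.re} \ (↑Sp : Set ℂ)))
    (hEc : ∀ z : ℂ, 2 < z.re → Ec z = eisensteinSeriesU (flatSectionU φ z))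
    (Fp : (quasiSplit (↥(maximalRealSubfield L)) L (IsCMField.complexConj L) 3).Adelic → ℂ → ℂ) (hF : ∀ g, AnalyticAt ℂ (Fp g) ((3 : ℂ) / 2))
    (hFE : ∀ g, Fp g =ᶠ[𝓝[≠] ((3 : ℂ) / 2)] fun z => (z - (3 : ℂ) / 2) * Ec z g)
    (Ecι : ι → ℂ → (quasiSplit (↥(maximalRealSubfield L)) L (IsCMField.complexConj L) 3).Adelic → ℂ) (Spι : ι → Finset ℂ) (hSpι : ∀ i ∈ s, ∀ t ∈ Spι i, t.im = 0 ∧ 1 < t.re ∧ t.re ≤ 2)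
    (holι : ∀ i ∈ s, ∀ y, DifferentiableOn ℂ (fun z => Ecι i z y) ({z : ℂ | 1 < z.re} \ (↑(Spι i) : Set ℂ)))
    (hEcι : ∀ i ∈ s, ∀ z : ℂ, 2 < z.re → Ecι i z = eisensteinSeriesU (flatSectionU (ψ i) z))
    (Fpι : ι → (quasiSplit (↥(maximalRealSubfield L)) L (IsCMField.complexConj L) 3).Adelic → ℂ → ℂ) (hFι : ∀ i ∈ s, ∀ y, AnalyticAt ℂ (Fpι i y) ((3 : ℂ) / 2))
    (hFEι : ∀ i ∈ s, ∀ y, Fpι i y =ᶠ[𝓝[≠] ((3 : ℂ) / 2)] fun z => (z - (3 : ℂ) / 2) * Ecι i z y)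
    (x : (quasiSplit (↥(maximalRealSubfield L)) L (IsCMField.complexConj L) 3).Adelic) :
    Fp x ((3 : ℂ) / 2) = ∑ i ∈ s, a i * Fpι i x ((3 : ℂ) / 2) := by
  -- the scaled pieces `aᵢ • ψᵢ` and their data
  have hψ' : ∀ i ∈ s, a i • ψ i ∈ chiSectionSpacePair (ξ.bcη⁻¹ * ξ.bcψ⁻¹ * μω) ξ.ψ (⊥ : Subgroup (quasiSplit (↥(maximalRealSubfield L)) L (IsCMField.complexConj L) 3).Adelic)
      ((1 : ↥(⊥ : Subgroup (quasiSplit (↥(maximalRealSubfield L)) L (IsCMField.complexConj L) 3).Adelic) →* ℂ) :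
        ↥(⊥ : Subgroup (quasiSplit (↥(maximalRealSubfield L)) L (IsCMField.complexConj L) 3).Adelic) → ℂ) := fun i hi => Submodule.smul_mem _ _ (hψ i hi)
  have hψc' : ∀ i ∈ s, Continuous (a i • ψ i) := fun i hi => (hψc i hi).const_smul (a i)
  have holι' : ∀ i ∈ s, ∀ y, DifferentiableOn ℂ (fun z => a i * Ecι i z y) ({z : ℂ | 1 < z.re} \ (↑(Spι i) : Set ℂ)) := fun i hi y => (holι i hi y).const_mul (a i)
  have hEcι' : ∀ i ∈ s, ∀ z : ℂ, 2 < z.re → (fun y => a i * Ecι i z y) = eisensteinSeriesU (flatSectionU (a i • ψ i) z) := by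
    intro i hi z hz
    have hflat : flatSectionU (a i • ψ i) z = a i • flatSectionU (ψ i) z := by
      funext y
      simp only [flatSectionU_apply, Pi.smul_apply, smul_eq_mul, mul_assoc]
    funext y
    rw [hflat, eisensteinSeriesU_smul, hEcι i hi z hz]
  have hFι' : ∀ i ∈ s, ∀ y, AnalyticAt ℂ (fun z => a i * Fpι i y z) ((3 : ℂ) / 2) := fun i hi y => analyticAt_const.mul (hFι i hi y)
  have hFEι' : ∀ i ∈ s, ∀ y, (fun z => a i * Fpι i y z) =ᶠ[𝓝[≠] ((3 : ℂ) / 2)] fun z => (z - (3 : ℂ) / 2) * (a i * Ecι i z y) := fun i hi y =>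
    (hFEι i hi y).mono fun z hz => by
      show a i * Fpι i y z = (z - (3 : ℂ) / 2) * (a i * Ecι i z y)
      rw [hz]; ring
  -- the (trivial) flat re-expansion at `g = 1` with weights `cᵢ = 1`
  have hdec : ∀ (z : ℂ) (y : (quasiSplit (↥(maximalRealSubfield L)) L (IsCMField.complexConj L) 3).Adelic),
      flatSectionU φ z (y * 1) = ∑ i ∈ s, ((((fun _ => (1 : ℝ≥0)) i : ℝ) : ℂ) ^ z) * flatSectionU (a i • ψ i) z y := by
    intro z y
    rw [mul_one, hφ, flatSectionU_finset_sum_smul]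
    refine Finset.sum_congr rfl fun i _ => ?_
    simp only [NNReal.coe_one, Complex.ofReal_one, Complex.one_cpow, one_mul, flatSectionU_apply, Pi.smul_apply, smul_eq_mul, mul_assoc]
  have h := midPoleLetter_translate_eq_sum L ξ μω hμu Ec Sp hSp hol hEc Fp hF hFE 1 s (fun _ => (1 : ℝ≥0)) (fun _ _ => one_pos) (fun i => a i • ψ i) hψ' hψc'
    (fun i z y => a i * Ecι i z y) Spι hSpι holι' hEcι' (fun i y z => a i * Fpι i y z) hFι' hFEι' hdec x
  rw [mul_one] at h
  rw [h]
  refine Finset.sum_congr rfl fun i _ => ?_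
  simp only [NNReal.coe_one, Complex.ofReal_one, Complex.one_cpow, one_mul]

/-! ## §2 LIN: the residue class is linear in the section -/

/-- **LIN — `Res (Σᵢ aᵢ ψᵢ) = Σᵢ aᵢ Res ψᵢ` IN `L²`** (RES-INT (M-a) line 1).  With the data of §1 and the classes `f =ᵐ x ↦ Fp((out x)⁻¹)(3∕2)`, `fᵢ =ᵐ x ↦ Fpᵢ((out x)⁻¹)(3∕2)` (D1's `hf` clauses):
`f = Σᵢ aᵢ • fᵢ` — ★ `rightRegular_apply_eq_sum_of_flatReexpansion` at `g = 1`, `cᵢ = 1`, pieces `aᵢ • ψᵢ` with classes `aᵢ • fᵢ`, then `R(1) f = f`.  Hence «`Res`» (section ↦ its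
middle-pole residue class, well defined by uniqueness of continuation) is a LINEAR map on every space of sections carrying ESTATE T's data (the τ-blocks).
[cite: MoeglinWaldspurger1995, II.1.5, IV.1.11, V.3.13] -/
theorem res_class_finset_sum (hμu : μω.IsUnitary)
    {ι : Type*} (s : Finset ι) (a : ι → ℂ)
    (ψ : ι → (quasiSplit (↥(maximalRealSubfield L)) L (IsCMField.complexConj L) 3).Adelic → ℂ)
    (hψ : ∀ i ∈ s, ψ i ∈ chiSectionSpacePair (ξ.bcη⁻¹ * ξ.bcψ⁻¹ * μω) ξ.ψ (⊥ : Subgroup (quasiSplit (↥(maximalRealSubfield L)) L (IsCMField.complexConj L) 3).Adelic)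
      ((1 : ↥(⊥ : Subgroup (quasiSplit (↥(maximalRealSubfield L)) L (IsCMField.complexConj L) 3).Adelic) →* ℂ) :
        ↥(⊥ : Subgroup (quasiSplit (↥(maximalRealSubfield L)) L (IsCMField.complexConj L) 3).Adelic) → ℂ))
    (hψc : ∀ i ∈ s, Continuous (ψ i))
    {φ : (quasiSplit (↥(maximalRealSubfield L)) L (IsCMField.complexConj L) 3).Adelic → ℂ} (hφ : φ = ∑ i ∈ s, a i • ψ i)
    (Ec : ℂ → (quasiSplit (↥(maximalRealSubfield L)) L (IsCMField.complexConj L) 3).Adelic → ℂ) (Sp : Finset ℂ) (hSp : ∀ t ∈ Sp, t.im = 0 ∧ 1 < t.re ∧ t.re ≤ 2)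
    (hol : ∀ g, DifferentiableOn ℂ (fun z => Ec z g) ({z : ℂ | 1 < z.re} \ (↑Sp : Set ℂ)))
    (hEc : ∀ z : ℂ, 2 < z.re → Ec z = eisensteinSeriesU (flatSectionU φ z))
    (Fp : (quasiSplit (↥(maximalRealSubfield L)) L (IsCMField.complexConj L) 3).Adelic → ℂ → ℂ) (hF : ∀ g, AnalyticAt ℂ (Fp g) ((3 : ℂ) / 2))
    (hFE : ∀ g, Fp g =ᶠ[𝓝[≠] ((3 : ℂ) / 2)] fun z => (z - (3 : ℂ) / 2) * Ec z g)
    {f : (quasiSplit (↥(maximalRealSubfield L)) L (IsCMField.complexConj L) 3).L2 μ}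
    (hae : (f : (quasiSplit (↥(maximalRealSubfield L)) L (IsCMField.complexConj L) 3).automorphicQuotient → ℂ) =ᵐ[μ]
      fun x => Fp (Quotient.out (x : (quasiSplit (↥(maximalRealSubfield L)) L (IsCMField.complexConj L) 3).Adelic ⧸
        (quasiSplit (↥(maximalRealSubfield L)) L (IsCMField.complexConj L) 3).quotientSubgroup))⁻¹ ((3 : ℂ) / 2))
    (Ecι : ι → ℂ → (quasiSplit (↥(maximalRealSubfield L)) L (IsCMField.complexConj L) 3).Adelic → ℂ) (Spι : ι → Finset ℂ) (hSpι : ∀ i ∈ s, ∀ t ∈ Spι i, t.im = 0 ∧ 1 < t.re ∧ t.re ≤ 2)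
    (holι : ∀ i ∈ s, ∀ y, DifferentiableOn ℂ (fun z => Ecι i z y) ({z : ℂ | 1 < z.re} \ (↑(Spι i) : Set ℂ)))
    (hEcι : ∀ i ∈ s, ∀ z : ℂ, 2 < z.re → Ecι i z = eisensteinSeriesU (flatSectionU (ψ i) z))
    (Fpι : ι → (quasiSplit (↥(maximalRealSubfield L)) L (IsCMField.complexConj L) 3).Adelic → ℂ → ℂ) (hFι : ∀ i ∈ s, ∀ y, AnalyticAt ℂ (Fpι i y) ((3 : ℂ) / 2))
    (hFEι : ∀ i ∈ s, ∀ y, Fpι i y =ᶠ[𝓝[≠] ((3 : ℂ) / 2)] fun z => (z - (3 : ℂ) / 2) * Ecι i z y)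
    (fι : ι → (quasiSplit (↥(maximalRealSubfield L)) L (IsCMField.complexConj L) 3).L2 μ)
    (haeι : ∀ i ∈ s, ((fι i : (quasiSplit (↥(maximalRealSubfield L)) L (IsCMField.complexConj L) 3).L2 μ) :
        (quasiSplit (↥(maximalRealSubfield L)) L (IsCMField.complexConj L) 3).automorphicQuotient → ℂ) =ᵐ[μ]
      fun x => Fpι i (Quotient.out (x : (quasiSplit (↥(maximalRealSubfield L)) L (IsCMField.complexConj L) 3).Adelic ⧸
        (quasiSplit (↥(maximalRealSubfield L)) L (IsCMField.complexConj L) 3).quotientSubgroup))⁻¹ ((3 : ℂ) / 2)) :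
    f = ∑ i ∈ s, a i • fι i := by
  -- membership of the sum, the scaled pieces and their data
  have hφmem : φ ∈ chiSectionSpacePair (ξ.bcη⁻¹ * ξ.bcψ⁻¹ * μω) ξ.ψ (⊥ : Subgroup (quasiSplit (↥(maximalRealSubfield L)) L (IsCMField.complexConj L) 3).Adelic)
      ((1 : ↥(⊥ : Subgroup (quasiSplit (↥(maximalRealSubfield L)) L (IsCMField.complexConj L) 3).Adelic) →* ℂ) :
        ↥(⊥ : Subgroup (quasiSplit (↥(maximalRealSubfield L)) L (IsCMField.complexConj L) 3).Adelic) → ℂ) := by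
    rw [hφ]
    exact Submodule.sum_mem _ fun i hi => Submodule.smul_mem _ _ (hψ i hi)
  have hψ' : ∀ i ∈ s, a i • ψ i ∈ chiSectionSpacePair (ξ.bcη⁻¹ * ξ.bcψ⁻¹ * μω) ξ.ψ (⊥ : Subgroup (quasiSplit (↥(maximalRealSubfield L)) L (IsCMField.complexConj L) 3).Adelic)
      ((1 : ↥(⊥ : Subgroup (quasiSplit (↥(maximalRealSubfield L)) L (IsCMField.complexConj L) 3).Adelic) →* ℂ) :
        ↥(⊥ : Subgroup (quasiSplit (↥(maximalRealSubfield L)) L (IsCMField.complexConj L) 3).Adelic) → ℂ) := fun i hi => Submodule.smul_mem _ _ (hψ i hi)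
  have hψc' : ∀ i ∈ s, Continuous (a i • ψ i) := fun i hi => (hψc i hi).const_smul (a i)
  have holι' : ∀ i ∈ s, ∀ y, DifferentiableOn ℂ (fun z => a i * Ecι i z y) ({z : ℂ | 1 < z.re} \ (↑(Spι i) : Set ℂ)) := fun i hi y => (holι i hi y).const_mul (a i)
  have hEcι' : ∀ i ∈ s, ∀ z : ℂ, 2 < z.re → (fun y => a i * Ecι i z y) = eisensteinSeriesU (flatSectionU (a i • ψ i) z) := by
    intro i hi z hz
    have hflat : flatSectionU (a i • ψ i) z = a i • flatSectionU (ψ i) z := by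
      funext y
      simp only [flatSectionU_apply, Pi.smul_apply, smul_eq_mul, mul_assoc]
    funext y
    rw [hflat, eisensteinSeriesU_smul, hEcι i hi z hz]
  have hFι' : ∀ i ∈ s, ∀ y, AnalyticAt ℂ (fun z => a i * Fpι i y z) ((3 : ℂ) / 2) := fun i hi y => analyticAt_const.mul (hFι i hi y)
  have hFEι' : ∀ i ∈ s, ∀ y, (fun z => a i * Fpι i y z) =ᶠ[𝓝[≠] ((3 : ℂ) / 2)] fun z => (z - (3 : ℂ) / 2) * (a i * Ecι i z y) := fun i hi y =>
    (hFEι i hi y).mono fun z hz => by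
      show a i * Fpι i y z = (z - (3 : ℂ) / 2) * (a i * Ecι i z y)
      rw [hz]; ring
  have haeι' : ∀ i ∈ s, (((a i • fι i : (quasiSplit (↥(maximalRealSubfield L)) L (IsCMField.complexConj L) 3).L2 μ)) :
        (quasiSplit (↥(maximalRealSubfield L)) L (IsCMField.complexConj L) 3).automorphicQuotient → ℂ) =ᵐ[μ]
      fun x => (fun y z => a i * Fpι i y z) (Quotient.out (x : (quasiSplit (↥(maximalRealSubfield L)) L (IsCMField.complexConj L) 3).Adelic ⧸
        (quasiSplit (↥(maximalRealSubfield L)) L (IsCMField.complexConj L) 3).quotientSubgroup))⁻¹ ((3 : ℂ) / 2) := by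
    intro i hi
    filter_upwards [Lp.coeFn_smul (a i) (fι i), haeι i hi] with x hx hx'
    rw [hx, Pi.smul_apply, hx', smul_eq_mul]
  have hdec : ∀ (z : ℂ) (y : (quasiSplit (↥(maximalRealSubfield L)) L (IsCMField.complexConj L) 3).Adelic),
      flatSectionU φ z (y * 1) = ∑ i ∈ s, ((((fun _ => (1 : ℝ≥0)) i : ℝ) : ℂ) ^ z) * flatSectionU (a i • ψ i) z y := by
    intro z y
    rw [mul_one, hφ, flatSectionU_finset_sum_smul]
    refine Finset.sum_congr rfl fun i _ => ?_
    simp only [NNReal.coe_one, Complex.ofReal_one, Complex.one_cpow, one_mul, flatSectionU_apply, Pi.smul_apply, smul_eq_mul, mul_assoc]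
  have h := rightRegular_apply_eq_sum_of_flatReexpansion L μ ξ μω hμu hφmem Ec Sp hSp hol hEc Fp hF hFE hae 1 s (fun _ => (1 : ℝ≥0)) (fun _ _ => one_pos)
    (fun i => a i • ψ i) hψ' hψc' (fun i z y => a i * Ecι i z y) Spι hSpι holι' hEcι' (fun i y z => a i * Fpι i y z) hFι' hFEι' (fun i => a i • fι i) haeι' hdec
  have h1 : ((quasiSplit (↥(maximalRealSubfield L)) L (IsCMField.complexConj L) 3).rightRegular μ) 1 f = f := by
    rw [map_one]; rfl
  rw [h1] at h
  rw [h]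
  refine Finset.sum_congr rfl fun i _ => ?_
  simp only [NNReal.coe_one, Complex.ofReal_one, Complex.one_cpow, one_smul]

end Summit.HodgeConjecture.HodgeConjecture.R90.S8

end
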